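import Literature.Geometry.Kaehler.ComplexTorusHodgeGroupLieAlgebraAlgebraic
import Literature.Geometry.Kaehler.ComplexTorusMumfordTateLieAlgebraRatComplexFunctoriality
import Literature.Geometry.Kaehler.ComplexTorusMumfordTateGroupGeneratedByCocharacters
import Literature.Geometry.Kaehler.ComplexTorusHodgeGroupProductDual
import Literature.Geometry.Kaehler.ComplexTorusHodgeGroupProductDimensionCriterion
import HarnessLib

/-!
# The dimension dictionary `dim_ℝ 𝔥𝔤_ℝ = dim Hg(X)`, `dim_ℂ 𝔪𝔱_ℂ = dim MT(X) = dim Hg(X) + 1` at work: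
# the Mumford–Tate bridge, powers, the dual product, and "a product splits iff `dim 𝔥𝔤` is additive"

Layer `Literature/Geometry/Kaehler`, namespace `Literature.Geometry.Kaehler.ComplexTorus`; lane `lit-hodgefound`
(Track 2 foundations library), Layer A4; prover seat `lit-hodgefound-p17` (generation 39, self-proposed row g39-#10).
Companion to g39-#9a ∕ #9b (`LieAlgebraGLExponential`: Goodman–Wallach 1.4.10 for every algebraic `G ≤ GL(n, ℂ)`;
`ComplexTorusHodgeGroupLieAlgebraAlgebraic`: `hodgeGroupComplexLie = Lie(Hg(X)(ℂ))`, `dim_ℝ 𝔥𝔤_ℝ = zdim Hg(X)`). Here: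

* §1 the same bridge for the MUMFORD–TATE group (`mumfordTateComplexLie Φ`'s carrier is literally the complex one-parameter
  description): **`mumfordTateComplexLie_eq_lieSubalgebraGL`**, `finrank_mumfordTateComplexLie_eq_zdim`,
  `finrank_mumfordTateLie_eq_zdim`, and the trunk-dimension form of `𝔪𝔱_ℂ = ℂ·1 ⊕ 𝔤`:
  **`zdim_mumfordTateGroupC_eq_zdim_hodgeGroupC_add_one`** (`dim MT(X) = dim Hg(X) + 1`), `IsIsogenous.zdim_mumfordTateGroupC_eq`;
* §2 powers: **`zdim_hodgeGroupC_pow`** (`dim Hg(Xᴺ) = dim Hg(X)`), `zdim_mumfordTateGroupC_pow`;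
* §3 the dual product: `zdim_hodgeGroupC_prod_dualPeriod` (`dim Hg(X × X̂) = dim Hg(X)`);
* §4 products, read on the analytic Lie algebras through the dictionary:
  **`hodgeGroupC_prod_eq_blockDiagProd_iff_finrank_hodgeGroupLie_eq_add`** (`Hg(X₁ × X₂) = Hg(X₁) × Hg(X₂) ⟺
  dim_ℝ 𝔥𝔤_ℝ(X₁ × X₂) = dim_ℝ 𝔥𝔤_ℝ(X₁) + dim_ℝ 𝔥𝔤_ℝ(X₂)`), its complex form, the strict form, the real-points and the
  Hodge-classes-of-powers consequences.

THEOREMS ONLY (no definition, no instance, no named fact; net debt 0); nothing restated (the analytic inputs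
`finrank_mumfordTateComplexLie`, `finrank_hodgeGroupComplexLie_pow`, `finrank_hodgeGroupLie_prod_dual` and the trunk criterion
`hodgeGroupC_prod_eq_blockDiagProd_iff_zdim_eq_add` are imported).

## Sources

* R. Goodman, N. R. Wallach [GoodmanWallachGTM255], §1.4.4 Thm. 1.4.10; §1.7.1 (1.61).
* M. Green, P. Griffiths, M. Kerr [GreenGriffithsKerr2012], §I.A (p. 35: `M_φ = 𝔾_m · M_φ⁰`… `dim 𝔪𝔱 = dim 𝔥𝔤 + 1`), §I.B (I.B.3).
* B. Moonen, Yu. G. Zarhin [MoonenZarhin1999LowDim], §1 (powers), (0.2)(4) (isogeny), §3 (3.1) (products).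
* B. B. Gordon [Gordon1997], §2.16 Proposition.
* T. A. Springer [Springer1998], 1.8.1–1.8.2, 5.3.2 (ii).

## References

* [GoodmanWallachGTM255] R. Goodman, N. R. Wallach, *Symmetry, Representations, and Invariants*, GTM 255 (2009).
* [GreenGriffithsKerr2012] M. Green, P. Griffiths, M. Kerr, *Mumford–Tate Groups and Domains*, Princeton (2012).
* [MoonenZarhin1999LowDim] B. Moonen, Yu. G. Zarhin, Math. Ann. 315 (1999) 711–733.
* [Gordon1997] B. B. Gordon, *A survey of the Hodge conjecture for abelian varieties* (1997), §2.16.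
* [Springer1998] T. A. Springer, *Linear Algebraic Groups*, 2nd ed. (1998).
-/

noncomputable section

open Matrix Module NormedSpace

namespace Literature.Geometry.Kaehler

namespace ComplexTorus

open Literature.NumberTheory.Automorphic (IsZConnected lieAlgebraGL lieSubalgebraGL)

variable {ι : Type*} [Fintype ι] [DecidableEq ι] {E : Type*} [NormedAddCommGroup E] [NormedSpace ℂ E]
  (Φ : (ι → ℝ) ≃L[ℝ] E)

/-! ## §1 The Mumford–Tate bridge and `dim MT(X) = dim Hg(X) + 1` -/

/-- **`Z ∈ 𝔪𝔱_ℂ ⟺ Z ∈ Lie(MT(X)(ℂ))`** (Goodman–Wallach 1.4.10 for `G = MT(X)(ℂ)`). [cite: GoodmanWallachGTM255, §1.4.4 Theorem 1.4.10]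
[cite: GreenGriffithsKerr2012, §I.A (p. 35)] -/
theorem mem_mumfordTateComplexLie_iff_mem_lieAlgebraGL {Z : Matrix ι ι ℂ} :
    Z ∈ mumfordTateComplexLie Φ ↔ Z ∈ lieAlgebraGL (mumfordTateGroupC Φ) :=
  (Literature.NumberTheory.Automorphic.mem_lieAlgebraGL_iff_forall_exp_smul_mem (isAlgebraicSubgroup_mumfordTateGroupC Φ)).symm

/-- **`mumfordTateComplexLie Φ = lieSubalgebraGL (MT(X)(ℂ))`.** [cite: GoodmanWallachGTM255, §1.4.4 Theorem 1.4.10] -/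
theorem mumfordTateComplexLie_eq_lieSubalgebraGL : mumfordTateComplexLie Φ = lieSubalgebraGL (mumfordTateGroupC Φ) := by
  letI : LieRing (Matrix ι ι ℂ) := LieRing.ofAssociativeRing
  letI : LieAlgebra ℂ (Matrix ι ι ℂ) := LieAlgebra.ofAssociativeAlgebra
  exact LieSubalgebra.ext _ _ fun _ ↦ mem_mumfordTateComplexLie_iff_mem_lieAlgebraGL Φ

/-- Carrier form. [cite: GoodmanWallachGTM255, §1.4.4 Theorem 1.4.10] -/
theorem coe_mumfordTateComplexLie_eq_coe_lieAlgebraGL :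
    (mumfordTateComplexLie Φ : Set (Matrix ι ι ℂ)) = lieAlgebraGL (mumfordTateGroupC Φ) :=
  Set.ext fun _ ↦ mem_mumfordTateComplexLie_iff_mem_lieAlgebraGL Φ

/-- **`dim_ℂ 𝔪𝔱_ℂ = dim MT(X)`** (trunk `zdim` of the Zariski-connected `MT(X)(ℂ)`). [cite: Springer1998, 1.8.1 and 4.4.5–4.4.8]
[cite: GoodmanWallachGTM255, §1.4.4 Theorem 1.4.10] -/
theorem finrank_mumfordTateComplexLie_eq_zdim :
    finrank ℂ (mumfordTateComplexLie Φ) = (isZConnected_mumfordTateGroupC Φ).zdim := by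
  letI : LieRing (Matrix ι ι ℂ) := LieRing.ofAssociativeRing
  letI : LieAlgebra ℂ (Matrix ι ι ℂ) := LieAlgebra.ofAssociativeAlgebra
  have h : (mumfordTateComplexLie Φ).toSubmodule = lieAlgebraGL (mumfordTateGroupC Φ) :=
    Submodule.ext fun _ ↦ mem_mumfordTateComplexLie_iff_mem_lieAlgebraGL Φ
  change finrank ℂ (mumfordTateComplexLie Φ).toSubmodule = _
  rw [h, (isZConnected_mumfordTateGroupC Φ).finrank_lieAlgebraGL_eq.2]

/-- **`dim_ℝ 𝔪𝔱_ℝ = dim MT(X)`.** [cite: GoodmanWallachGTM255, §1.7.1 (1.61)] [cite: Springer1998, 1.8.1] -/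
theorem finrank_mumfordTateLie_eq_zdim : finrank ℝ (mumfordTateLie Φ) = (isZConnected_mumfordTateGroupC Φ).zdim := by
  rw [← finrank_mumfordTateComplexLie_eq_finrank_mumfordTateLie, finrank_mumfordTateComplexLie_eq_zdim]

/-- **`dim MT(X) = dim Hg(X) + 1`** (`X ≠ 0`): `𝔪𝔱_ℂ = ℂ·1 ⊕ 𝔤`, read through the dictionary. [cite: GreenGriffithsKerr2012, §I.A (p. 35)]
[cite: Springer1998, 1.8.1] -/
theorem zdim_mumfordTateGroupC_eq_zdim_hodgeGroupC_add_one [Nonempty ι] :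
    (isZConnected_mumfordTateGroupC Φ).zdim = (isZConnected_map_toGL_hodgeGroupC Φ).zdim + 1 := by
  rw [← finrank_mumfordTateComplexLie_eq_zdim, ← finrank_hodgeGroupComplexLie_eq_zdim, finrank_mumfordTateComplexLie]

/-- `dim_ℂ Lie(MT(X)(ℂ)) = dim_ℂ Lie(Hg(X)(ℂ)) + 1` on the trunk's Lie algebras. [cite: GreenGriffithsKerr2012, §I.A (p. 35)] -/
theorem finrank_lieAlgebraGL_mumfordTateGroupC_eq_add_one [Nonempty ι] :
    finrank ℂ (lieAlgebraGL (mumfordTateGroupC Φ)) =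
      finrank ℂ (lieAlgebraGL ((hodgeGroupC Φ).map Matrix.SpecialLinearGroup.toGL)) + 1 := by
  rw [(isZConnected_mumfordTateGroupC Φ).finrank_lieAlgebraGL_eq.2, (isZConnected_map_toGL_hodgeGroupC Φ).finrank_lieAlgebraGL_eq.2,
    zdim_mumfordTateGroupC_eq_zdim_hodgeGroupC_add_one]

section Isogeny

variable {ι₂ : Type*} [Fintype ι₂] [DecidableEq ι₂] {E₂ : Type*} [NormedAddCommGroup E₂] [NormedSpace ℂ E₂]
  {Φ} {Φ₂ : (ι₂ → ℝ) ≃L[ℝ] E₂}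

/-- **Isogenous tori have Mumford–Tate groups of the same dimension.** [cite: MoonenZarhin1999LowDim, (0.2)(4)]
[cite: GreenGriffithsKerr2012, §I.B (I.B.4)] -/
theorem IsIsogenous.zdim_mumfordTateGroupC_eq (h : IsIsogenous Φ Φ₂) :
    (isZConnected_mumfordTateGroupC Φ).zdim = (isZConnected_mumfordTateGroupC Φ₂).zdim := by
  rw [← finrank_mumfordTateComplexLie_eq_zdim, ← finrank_mumfordTateComplexLie_eq_zdim, h.finrank_mumfordTateComplexLie_eq]

end Isogeny

/-! ## §2 Powers -/

/-- **`dim Hg(Xᴺ) = dim Hg(X)`** (`N ≥ 1`; `Hg(Xᴺ) = Δ_N Hg(X)`). [cite: MoonenZarhin1999LowDim, §1] [cite: GreenGriffithsKerr2012, §I.B (I.B.3)] -/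
theorem zdim_hodgeGroupC_pow {N : ℕ} (hN : 0 < N) :
    (isZConnected_map_toGL_hodgeGroupC (powPeriod Φ N)).zdim = (isZConnected_map_toGL_hodgeGroupC Φ).zdim := by
  rw [← finrank_hodgeGroupComplexLie_eq_zdim, ← finrank_hodgeGroupComplexLie_eq_zdim, finrank_hodgeGroupComplexLie_pow Φ hN]

/-- **`dim MT(Xᴺ) = dim MT(X)`** (`N ≥ 1`). [cite: MoonenZarhin1999LowDim, §1] [cite: Moonen2004MT, §9 Exercise 4.10] -/
theorem zdim_mumfordTateGroupC_pow {N : ℕ} (hN : 0 < N) :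
    (isZConnected_mumfordTateGroupC (powPeriod Φ N)).zdim = (isZConnected_mumfordTateGroupC Φ).zdim := by
  rw [← finrank_mumfordTateComplexLie_eq_zdim, ← finrank_mumfordTateComplexLie_eq_zdim, finrank_mumfordTateComplexLie_pow Φ _ hN]

/-- `dim_ℂ Lie(Hg(Xᴺ)(ℂ)) = dim_ℂ Lie(Hg(X)(ℂ))` on the trunk's Lie algebras. [cite: MoonenZarhin1999LowDim, §1] -/
theorem finrank_lieAlgebraGL_hodgeGroupC_pow {N : ℕ} (hN : 0 < N) :
    finrank ℂ (lieAlgebraGL ((hodgeGroupC (powPeriod Φ N)).map Matrix.SpecialLinearGroup.toGL)) =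
      finrank ℂ (lieAlgebraGL ((hodgeGroupC Φ).map Matrix.SpecialLinearGroup.toGL)) := by
  rw [(isZConnected_map_toGL_hodgeGroupC _).finrank_lieAlgebraGL_eq.2, (isZConnected_map_toGL_hodgeGroupC Φ).finrank_lieAlgebraGL_eq.2,
    zdim_hodgeGroupC_pow Φ hN]

/-! ## §3 The dual product `X × X̂` -/

/-- **`dim Hg(X × X̂) = dim Hg(X)`** (`Hg(X × X̂)` is the graph of the contragredient). [cite: GreenGriffithsKerr2012, §I.B (I.B.3)]
[cite: Moonen1999MTNotes, (1.8) Remark] -/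
theorem zdim_hodgeGroupC_prod_dualPeriod :
    (isZConnected_map_toGL_hodgeGroupC (prodPeriod Φ (dualPeriod Φ))).zdim = (isZConnected_map_toGL_hodgeGroupC Φ).zdim := by
  rw [← finrank_hodgeGroupLie_eq_zdim, ← finrank_hodgeGroupLie_eq_zdim, finrank_hodgeGroupLie_prod_dual]

/-! ## §4 Products: `Hg(X₁ × X₂) = Hg(X₁) × Hg(X₂)` iff `dim 𝔥𝔤` is additive -/

section Product

variable {ι₂ : Type*} [Fintype ι₂] [DecidableEq ι₂] {E₂ : Type*} [NormedAddCommGroup E₂] [NormedSpace ℂ E₂]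
  (Φ₂ : (ι₂ → ℝ) ≃L[ℝ] E₂)

/-- **`Hg(X₁ × X₂) = Hg(X₁) × Hg(X₂) ⟺ dim_ℝ 𝔥𝔤_ℝ(X₁ × X₂) = dim_ℝ 𝔥𝔤_ℝ(X₁) + dim_ℝ 𝔥𝔤_ℝ(X₂)`** — the trunk criterion
`hodgeGroupC_prod_eq_blockDiagProd_iff_zdim_eq_add` read on the analytic Lie algebras. [cite: MoonenZarhin1999LowDim, §3 (3.1)]
[cite: Gordon1997, §2.16 Proposition] [cite: Springer1998, 1.8.2 and 5.3.2 (ii)] -/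
theorem hodgeGroupC_prod_eq_blockDiagProd_iff_finrank_hodgeGroupLie_eq_add :
    hodgeGroupC (prodPeriod Φ Φ₂) = blockDiagProd (hodgeGroupC Φ) (hodgeGroupC Φ₂) ↔
      finrank ℝ (hodgeGroupLie (prodPeriod Φ Φ₂)) = finrank ℝ (hodgeGroupLie Φ) + finrank ℝ (hodgeGroupLie Φ₂) := by
  rw [hodgeGroupC_prod_eq_blockDiagProd_iff_zdim_eq_add, finrank_hodgeGroupLie_eq_zdim, finrank_hodgeGroupLie_eq_zdim,
    finrank_hodgeGroupLie_eq_zdim]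

/-- Complex form: `Hg(X₁ × X₂) = Hg(X₁) × Hg(X₂) ⟺ dim_ℂ 𝔥𝔤_ℂ(X₁ × X₂) = dim_ℂ 𝔥𝔤_ℂ(X₁) + dim_ℂ 𝔥𝔤_ℂ(X₂)`.
[cite: MoonenZarhin1999LowDim, §3 (3.1)] [cite: Gordon1997, §2.16 Proposition] -/
theorem hodgeGroupC_prod_eq_blockDiagProd_iff_finrank_hodgeGroupComplexLie_eq_add :
    hodgeGroupC (prodPeriod Φ Φ₂) = blockDiagProd (hodgeGroupC Φ) (hodgeGroupC Φ₂) ↔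
      finrank ℂ (hodgeGroupComplexLie (prodPeriod Φ Φ₂)) =
        finrank ℂ (hodgeGroupComplexLie Φ) + finrank ℂ (hodgeGroupComplexLie Φ₂) := by
  rw [hodgeGroupC_prod_eq_blockDiagProd_iff_zdim_eq_add, finrank_hodgeGroupComplexLie_eq_zdim, finrank_hodgeGroupComplexLie_eq_zdim,
    finrank_hodgeGroupComplexLie_eq_zdim]

/-- **`Hg(X₁ × X₂) ⊊ Hg(X₁) × Hg(X₂) ⟺ dim_ℝ 𝔥𝔤_ℝ(X₁ × X₂) < dim_ℝ 𝔥𝔤_ℝ(X₁) + dim_ℝ 𝔥𝔤_ℝ(X₂)`.** [cite: MoonenZarhin1999LowDim, §3 (3.1) (1)] -/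
theorem hodgeGroupC_prod_ne_blockDiagProd_iff_finrank_hodgeGroupLie_lt_add :
    hodgeGroupC (prodPeriod Φ Φ₂) ≠ blockDiagProd (hodgeGroupC Φ) (hodgeGroupC Φ₂) ↔
      finrank ℝ (hodgeGroupLie (prodPeriod Φ Φ₂)) < finrank ℝ (hodgeGroupLie Φ) + finrank ℝ (hodgeGroupLie Φ₂) := by
  rw [hodgeGroupC_prod_ne_blockDiagProd_iff_zdim_lt_add, finrank_hodgeGroupLie_eq_zdim, finrank_hodgeGroupLie_eq_zdim,
    finrank_hodgeGroupLie_eq_zdim]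

/-- Real points: `dim_ℝ 𝔥𝔤_ℝ` additive ⟹ `Hg(X₁ × X₂)(ℝ) = Hg(X₁)(ℝ) × Hg(X₂)(ℝ)`. [cite: MoonenZarhin1999LowDim, §3 (3.1)] -/
theorem hodgeGroup_prod_eq_of_finrank_hodgeGroupLie_eq_add
    (h : finrank ℝ (hodgeGroupLie (prodPeriod Φ Φ₂)) = finrank ℝ (hodgeGroupLie Φ) + finrank ℝ (hodgeGroupLie Φ₂)) :
    hodgeGroup (prodPeriod Φ Φ₂) = ((hodgeGroup Φ).prod (hodgeGroup Φ₂)).map (blockDiag ι ι₂) :=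
  hodgeGroup_prod_eq_of_zdim_eq_add Φ Φ₂
    (by rwa [finrank_hodgeGroupLie_eq_zdim, finrank_hodgeGroupLie_eq_zdim, finrank_hodgeGroupLie_eq_zdim] at h)

variable {Φ Φ₂} in
/-- `dim_ℝ 𝔥𝔤_ℝ` additive and (D) for all powers of each factor ⟹ (D) for all powers of `X₁ × X₂`. [cite: MoonenZarhin1999LowDim, §3 (3.1)]
[cite: Gordon1997, §2.16 Proposition and §3 Theorem] -/
theorem forall_divisorClasses_powPeriod_prod_eq_hodgeClasses_of_finrank_hodgeGroupLie_eq_add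
    (h : finrank ℝ (hodgeGroupLie (prodPeriod Φ Φ₂)) = finrank ℝ (hodgeGroupLie Φ) + finrank ℝ (hodgeGroupLie Φ₂))
    (hX₁ : ∀ k p, divisorClasses (powPeriod Φ k) p = hodgeClasses (powPeriod Φ k) p)
    (hX₂ : ∀ k p, divisorClasses (powPeriod Φ₂ k) p = hodgeClasses (powPeriod Φ₂ k) p) :
    ∀ k p, divisorClasses (powPeriod (prodPeriod Φ Φ₂) k) p = hodgeClasses (powPeriod (prodPeriod Φ Φ₂) k) p :=
  forall_divisorClasses_powPeriod_prod_eq_hodgeClasses_of_zdim_eq_add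
    (by rwa [finrank_hodgeGroupLie_eq_zdim, finrank_hodgeGroupLie_eq_zdim, finrank_hodgeGroupLie_eq_zdim] at h) hX₁ hX₂

end Product

end ComplexTorus

end Literature.Geometry.Kaehler

end
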